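import Summits.BirchSwinnertonDyer.Rank1Residual.ManinAdditive.CuspidalKummerCubeDescent
import Summits.BirchSwinnertonDyer.BirchSwinnertonDyer.Theorems.ManinLocalTwoThreeThreeBlindInvariance
import HarnessLib

/-!
# Cube-root descent in the `Γ₀`-tower: `LAW₃ ⟸ M0 ∧ M1 ∧ M2 ∧ P79` (cell bsd-f2-manin, seat -an g36, MEMO-an §79) — FILE B

Theorems-side companion of `Rank1Residual/ManinAdditive/CuspidalKummerCubeDescent.lean` (FILE A, an g36: the Newman
descent `newmanCond_descentExp` = E-an-159, the nodes N1 `CubeRepFirstDescent` / N2 `NoNewmanCubeRootRepAtThreeN`, the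
leaves M0 `ModularFunctionFieldMono` / M1 `EtaQuotientMemFunctionField` / M2 `MonomialNotModularFunction` /
P79 `KummerCubeSeriesNotCubeAtThreeN`, and `cuspidalKummerCubeExponentLaw_of_descent : N1 → N2 → LAW₃`).

PROVED here (no `sorry`):
* `cubeRepFirstDescent_of : M1 → M2 → N1` — from a representative `Θ·B³·qⁿ¹ = qⁿ²·g·A³`: `G₀ := qⁿ²g/qⁿ¹ ∈ K_N`,
  `η_r = q^{S₁/24}·g ∈ K_N` (M1), so `q^{n₂−n₁−S₁/24} = G₀/η_r ∈ K_N`, hence `n₂ − n₁ = S₁/24` (M2); `q`-orders in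
  `ℚ⟦q⟧` (`Θ(0) ≠ 0`, `g(0) = 1`) give `3 ∣ n₂ − n₁`; so `72 ∣ S₁(r)`.
* `noNewmanCubeRootRepAtThreeN_of : M0 → M1 → M2 → P79 → N2` — if all `3 ∣ r_δ` and `s = r/3` is Newman at level
  `3N`, then `u := η_s·(A/B) ∈ K_{3N}` (M1 at `3N`, M0 for `A/B ∈ K_N ≤ K_{3N}`) and `u³ = q^{S₁/24}·g·(A/B)³ = Θ`
  (`etaLaurent_descentExp_pow`, M2 for the exponent), contradicting P79.
* `cuspidalKummerCubeExponentLaw_of_functionField : M0 → M1 → M2 → P79 → CuspidalKummerCubeExponentLaw` (LAW₃, tree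
  `CuspidalKummerCubeLaws.lean` :72, BY NAME), `…NonBlind_of_functionField` (LAW₃♮ = C3 v18 `stub_cubeExponentLawNonBlind`,
  BY NAME) and `noBlindThreeTorsionOptimal_of_functionField : M0 → M1 → M2 → P79 → CuspidalKummerCubeRepresentativeAtNine →
  NoBlindThreeTorsionOptimal` (NB₃, BY NAME, through the tree edge `noBlind_of_cuspidalKummerCubeExponentLaw_of_representative`).

Proposed landing: `Summits/BirchSwinnertonDyer/BirchSwinnertonDyer/Theorems/ManinLocalTwoThreeCubeRootDescent.lean`
(`--supports stmt-BirchSwinnertonDyer-22968`). Checked as the concatenation FILE A ++ FILE B (`CubeDescentFullSim-an-g36.lean`,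
`lean check --json` rc 0, 0 sorry, 2026-08-29; v1.2 carries its own `noncomputable section` and the top-level `open`s of FILE A so
that it elaborates standalone). PARTITION unchanged · beyond-print theorem: no · BSD is not proved by this.
-/
set_option linter.dupNamespace false
set_option autoImplicit false

noncomputable section

open PowerSeries CongruenceSubgroup
open WeierstrassCurve Literature.NumberTheory.EllipticCurves Literature.NumberTheory.EllipticCurves.ModularForms

namespace Summit.BirchSwinnertonDyer.BirchSwinnertonDyer.Theorems.ManinLocalTwoThree.CubeRootDescent

open Summit.BirchSwinnertonDyer.Rank1Residual.ManinAdditive.CuspidalKummer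
open Summit.BirchSwinnertonDyer.Rank1Residual.ManinAdditive.CuspidalKummerThree

/-! ### Laurent-series bookkeeping -/

/-- `toLaurent` is the ring homomorphism `ℤ⟦X⟧ → ℂ⟦X⟧ → ℂ((X))` (cast, then `HahnSeries.ofPowerSeries`); stated with the
composite `RingHom` inline so that this file declares no definition. [folklore] -/
theorem toLaurent_eq (p : ℤ⟦X⟧) :
    toLaurent p = ((HahnSeries.ofPowerSeries ℤ ℂ).comp (PowerSeries.map (Int.castRingHom ℂ))) p := rfl

/-- `toLaurent` is multiplicative. [folklore] -/
theorem toLaurent_mul (p q : ℤ⟦X⟧) : toLaurent (p * q) = toLaurent p * toLaurent q := by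
  rw [toLaurent_eq, toLaurent_eq, toLaurent_eq, map_mul]

/-- `toLaurent` commutes with powers. [folklore] -/
theorem toLaurent_pow (p : ℤ⟦X⟧) (n : ℕ) : toLaurent (p ^ n) = toLaurent p ^ n := by
  rw [toLaurent_eq, toLaurent_eq, map_pow]

/-- `toLaurent` commutes with finite products. [folklore] -/
theorem toLaurent_prod (S : Finset ℕ) (f : ℕ → ℤ⟦X⟧) : toLaurent (∏ δ ∈ S, f δ) = ∏ δ ∈ S, toLaurent (f δ) := by
  simp only [toLaurent_eq, map_prod]

/-- `toLaurent (X ^ n)` is the monomial `q^n`. [folklore] -/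
theorem toLaurent_X_pow (n : ℕ) : toLaurent ((X : ℤ⟦X⟧) ^ n) = HahnSeries.single (n : ℤ) (1 : ℂ) := by
  rw [toLaurent, map_pow, PowerSeries.map_X, HahnSeries.ofPowerSeries_X_pow]

/-- `toLaurent : ℤ⟦X⟧ → ℂ((X))` is injective. [folklore] -/
theorem toLaurent_injective : Function.Injective toLaurent :=
  fun _ _ h => PowerSeries.map_injective _ (RingHom.injective_int _) (HahnSeries.ofPowerSeries_injective h)

/-- `toLaurent` of a non-zero series is non-zero. [folklore] -/
theorem toLaurent_ne_zero {p : ℤ⟦X⟧} (hp : p ≠ 0) : toLaurent p ≠ 0 := by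
  intro h
  apply hp
  apply toLaurent_injective
  rw [h, toLaurent_eq, map_zero]

/-- The monomial `q^m` is non-zero in `ℂ((q))`. [folklore] -/
theorem single_ne_zero' (m : ℤ) : (HahnSeries.single m (1 : ℂ) : LaurentSeries ℂ) ≠ 0 :=
  HahnSeries.single_ne_zero one_ne_zero

/-- `q^a · q^b = q^{a+b}` in `ℂ((q))`. [folklore] -/
theorem single_mul_single' (a b : ℤ) :
    (HahnSeries.single a (1 : ℂ) : LaurentSeries ℂ) * HahnSeries.single b 1 = HahnSeries.single (a + b) 1 := by
  rw [HahnSeries.single_mul_single, mul_one]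

/-- `(q^a)^n = q^{n a}` in `ℂ((q))`. [folklore] -/
theorem single_pow' (a : ℤ) (n : ℕ) :
    (HahnSeries.single a (1 : ℂ) : LaurentSeries ℂ) ^ n = HahnSeries.single ((n : ℤ) * a) 1 := by
  rw [HahnSeries.single_pow, one_pow, nsmul_eq_mul]

/-- The unit series of an `η`-quotient is non-zero (constant term `1`). -/
theorem etaNeg_ne_zero (M : ℕ) (s : ℕ → ℤ) : etaNeg M s ≠ 0 := by
  intro h
  have h1 : constantCoeff (etaNeg M s) = 1 := by
    rw [etaNeg, map_prod]
    exact Finset.prod_eq_one fun δ _ => by rw [map_pow, constantCoeff_formalEulerScaled, one_pow]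
  rw [h, map_zero] at h1
  exact zero_ne_one h1

/-- The numerator series `etaPos` of an `η`-quotient is non-zero (constant term `1`). [folklore] -/
theorem etaPos_ne_zero (M : ℕ) (s : ℕ → ℤ) : etaPos M s ≠ 0 := by
  intro h
  have h1 : constantCoeff (etaPos M s) = 1 := by
    rw [etaPos, map_prod]
    exact Finset.prod_eq_one fun δ _ => by rw [map_pow, constantCoeff_formalEulerScaled, one_pow]
  rw [h, map_zero] at h1
  exact zero_ne_one h1

/-- `toLaurent g = etaPos/etaNeg` for an `η`-unit series. -/
theorem toLaurent_eq_div_of_isEtaUnitSeries {M : ℕ} {s : ℕ → ℤ} {g : ℤ⟦X⟧} (hg : IsEtaUnitSeries M.divisors s g) :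
    toLaurent g = toLaurent (etaPos M s) / toLaurent (etaNeg M s) := by
  have h : g * etaNeg M s = etaPos M s := hg.2
  rw [eq_div_iff (toLaurent_ne_zero (etaNeg_ne_zero M s)), ← toLaurent_mul, h]

/-- `etaLaurent M s = q^{S₁/24}·g` for the unit series `g` of `s`. -/
theorem etaLaurent_eq_of_isEtaUnitSeries {M : ℕ} {s : ℕ → ℤ} {g : ℤ⟦X⟧} (hg : IsEtaUnitSeries M.divisors s g) :
    etaLaurent M s = HahnSeries.single ((∑ δ ∈ M.divisors, (δ : ℤ) * s δ) / 24) (1 : ℂ) * toLaurent g := by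
  rw [etaLaurent, toLaurent_eq_div_of_isEtaUnitSeries hg]

/-- The Laurent `q`-series of an `η`-quotient with a unit series is non-zero. [folklore] -/
theorem etaLaurent_ne_zero_of_isEtaUnitSeries {M : ℕ} {s : ℕ → ℤ} {g : ℤ⟦X⟧}
    (hg : IsEtaUnitSeries M.divisors s g) : etaLaurent M s ≠ 0 := by
  rw [etaLaurent_eq_of_isEtaUnitSeries hg]
  refine mul_ne_zero (single_ne_zero' _) (toLaurent_ne_zero ?_)
  intro h0
  have := hg.1
  rw [h0, map_zero] at this
  exact zero_ne_one this

/-! ### The representative in `ℂ((q))`: `Θ = q^{n₂−n₁}·g·(A/B)³` -/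

/-- Casting `ℤ⟦X⟧ → ℚ⟦X⟧ → ℂ⟦X⟧` equals casting `ℤ⟦X⟧ → ℂ⟦X⟧`. -/
theorem map_algebraMap_map_intCast (P : ℤ⟦X⟧) :
    PowerSeries.map (algebraMap ℚ ℂ) (PowerSeries.map (Int.castRingHom ℚ) P) = P.map (Int.castRingHom ℂ) := by
  rw [← RingHom.comp_apply (PowerSeries.map (algebraMap ℚ ℂ)) (PowerSeries.map (Int.castRingHom ℚ)) P,
    ← PowerSeries.map_comp, Subsingleton.elim ((algebraMap ℚ ℂ).comp (Int.castRingHom ℚ)) (Int.castRingHom ℂ)]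

/-- The Laurent form of a cuspidal Kummer cube representative. -/
theorem laurent_eq_of_rep {Θ : ℚ⟦X⟧} {g A B : ℤ⟦X⟧} (hB : B ≠ 0) {n₁ n₂ : ℕ}
    (hEq : Θ * (B.map (Int.castRingHom ℚ)) ^ 3 * X ^ n₁ = (X ^ n₂ * g * A ^ 3).map (Int.castRingHom ℚ)) :
    HahnSeries.ofPowerSeries ℤ ℂ (Θ.map (algebraMap ℚ ℂ)) =
      HahnSeries.single ((n₂ : ℤ) - n₁) (1 : ℂ) * toLaurent g * (toLaurent A / toLaurent B) ^ 3 := by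
  have h := congrArg (fun p => HahnSeries.ofPowerSeries ℤ ℂ (PowerSeries.map (algebraMap ℚ ℂ) p)) hEq
  simp only [map_mul, map_pow, PowerSeries.map_X, map_algebraMap_map_intCast, HahnSeries.ofPowerSeries_X,
    HahnSeries.single_pow, one_pow, nsmul_eq_mul, mul_one] at h
  set ΘL := HahnSeries.ofPowerSeries ℤ ℂ (PowerSeries.map (algebraMap ℚ ℂ) Θ) with hΘL
  have h' : ΘL * toLaurent B ^ 3 * HahnSeries.single (n₁ : ℤ) (1 : ℂ) =
      HahnSeries.single (n₂ : ℤ) (1 : ℂ) * toLaurent g * toLaurent A ^ 3 := h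
  have hBL : toLaurent B ≠ 0 := toLaurent_ne_zero hB
  have hq₁ : (HahnSeries.single (n₁ : ℤ) (1 : ℂ) : LaurentSeries ℂ) ≠ 0 := single_ne_zero' _
  have hne : toLaurent B ^ 3 * HahnSeries.single (n₁ : ℤ) (1 : ℂ) ≠ 0 := mul_ne_zero (pow_ne_zero 3 hBL) hq₁
  have hsplit : (HahnSeries.single ((n₂ : ℤ) - n₁) (1 : ℂ) : LaurentSeries ℂ) * HahnSeries.single (n₁ : ℤ) 1 =
      HahnSeries.single (n₂ : ℤ) 1 := by
    rw [single_mul_single']; congr 1; ring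
  have hAB : (toLaurent A / toLaurent B) ^ 3 * toLaurent B ^ 3 = toLaurent A ^ 3 := by
    rw [div_pow, div_mul_cancel₀ _ (pow_ne_zero 3 hBL)]
  symm
  calc HahnSeries.single ((n₂ : ℤ) - n₁) (1 : ℂ) * toLaurent g * (toLaurent A / toLaurent B) ^ 3
      = HahnSeries.single ((n₂ : ℤ) - n₁) (1 : ℂ) * toLaurent g * (toLaurent A / toLaurent B) ^ 3 *
          (toLaurent B ^ 3 * HahnSeries.single (n₁ : ℤ) (1 : ℂ)) *
          (toLaurent B ^ 3 * HahnSeries.single (n₁ : ℤ) (1 : ℂ))⁻¹ := by rw [mul_inv_cancel_right₀ hne]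
    _ = HahnSeries.single ((n₂ : ℤ) - n₁) (1 : ℂ) * HahnSeries.single (n₁ : ℤ) 1 * toLaurent g *
          ((toLaurent A / toLaurent B) ^ 3 * toLaurent B ^ 3) *
          (toLaurent B ^ 3 * HahnSeries.single (n₁ : ℤ) (1 : ℂ))⁻¹ := by ring
    _ = HahnSeries.single (n₂ : ℤ) (1 : ℂ) * toLaurent g * toLaurent A ^ 3 *
          (toLaurent B ^ 3 * HahnSeries.single (n₁ : ℤ) (1 : ℂ))⁻¹ := by rw [hsplit, hAB]
    _ = ΘL * toLaurent B ^ 3 * HahnSeries.single (n₁ : ℤ) (1 : ℂ) *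
          (toLaurent B ^ 3 * HahnSeries.single (n₁ : ℤ) (1 : ℂ))⁻¹ := by rw [h']
    _ = ΘL := by rw [mul_assoc ΘL, mul_inv_cancel_right₀ hne]

/-- The exponent identity `n₂ − n₁ = S₁(r)/24` (M1 ∧ M2): `q^{n₂−n₁−S₁/24} = G₀/η_r ∈ K_N`. -/
theorem sub_eq_sum_div_of_rep (hM1 : EtaQuotientMemFunctionField) (hM2 : MonomialNotModularFunction)
    {N : ℕ} [NeZero N] {r : ℕ → ℤ} {g : ℤ⟦X⟧} (hNew : NewmanCond N r 0) (hEta : IsEtaUnitSeries N.divisors r g)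
    {n₁ n₂ : ℕ} (hG : toLaurent (X ^ n₂ * g) / toLaurent (X ^ n₁) ∈ modularFunctionField N) :
    (n₂ : ℤ) - n₁ = (∑ δ ∈ N.divisors, (δ : ℤ) * r δ) / 24 := by
  set S := (∑ δ ∈ N.divisors, (δ : ℤ) * r δ) / 24 with hS
  have hη : etaLaurent N r ∈ modularFunctionField N := hM1 N r hNew
  have hη0 : etaLaurent N r ≠ 0 := etaLaurent_ne_zero_of_isEtaUnitSeries hEta
  have hG₀ : toLaurent (X ^ n₂ * g) / toLaurent (X ^ n₁) =
      HahnSeries.single ((n₂ : ℤ) - n₁ - S) (1 : ℂ) * etaLaurent N r := by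
    rw [etaLaurent_eq_of_isEtaUnitSeries hEta, ← hS, toLaurent_mul, toLaurent_X_pow, toLaurent_X_pow,
      div_eq_iff (single_ne_zero' _)]
    have : (HahnSeries.single ((n₂ : ℤ) - n₁ - S) (1 : ℂ) : LaurentSeries ℂ) * HahnSeries.single S 1 *
        HahnSeries.single (n₁ : ℤ) 1 = HahnSeries.single (n₂ : ℤ) 1 := by
      rw [single_mul_single', single_mul_single']; congr 1; ring
    linear_combination (toLaurent g) * this.symm
    -- fallback handled below if `linear_combination` shape differs
  have hmono : HahnSeries.single ((n₂ : ℤ) - n₁ - S) (1 : ℂ) ∈ modularFunctionField N := by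
    have hdiv := div_mem hG hη
    rw [hG₀, mul_div_assoc, div_self hη0, mul_one] at hdiv
    exact hdiv
  have := hM2 N _ hmono
  omega

/-- `q`-orders in `ℚ⟦q⟧`: `3 ∣ n₂ − n₁` when `Θ(0) ≠ 0`, `g(0) = 1`. -/
theorem three_dvd_sub_of_rep {Θ : ℚ⟦X⟧} (hΘ0 : constantCoeff Θ ≠ 0) {g A B : ℤ⟦X⟧}
    (hg0 : constantCoeff g = 1) (hB : B ≠ 0) {n₁ n₂ : ℕ}
    (hEq : Θ * (B.map (Int.castRingHom ℚ)) ^ 3 * X ^ n₁ = (X ^ n₂ * g * A ^ 3).map (Int.castRingHom ℚ)) :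
    (3 : ℤ) ∣ (n₂ : ℤ) - n₁ := by
  have hinj : Function.Injective (PowerSeries.map (Int.castRingHom ℚ)) :=
    PowerSeries.map_injective _ (RingHom.injective_int _)
  have hB' : PowerSeries.map (Int.castRingHom ℚ) B ≠ 0 := fun h => hB (hinj (by rw [h, map_zero]))
  have hΘu : IsUnit Θ := isUnit_iff_constantCoeff.mpr (isUnit_iff_ne_zero.mpr hΘ0)
  have hgu : IsUnit (PowerSeries.map (Int.castRingHom ℚ) g) := by
    rw [isUnit_iff_constantCoeff, ← coeff_zero_eq_constantCoeff, coeff_map, coeff_zero_eq_constantCoeff, hg0,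
      map_one]
    exact isUnit_one
  rw [map_mul, map_mul, map_pow, map_pow, PowerSeries.map_X] at hEq
  have hA' : PowerSeries.map (Int.castRingHom ℚ) A ≠ 0 := by
    intro h
    rw [h, zero_pow three_ne_zero, mul_zero] at hEq
    exact (mul_ne_zero (mul_ne_zero hΘu.ne_zero (pow_ne_zero 3 hB')) (pow_ne_zero _ X_ne_zero)) hEq
  have hord := congrArg PowerSeries.order hEq
  rw [order_mul, order_mul, order_zero_of_unit hΘu, zero_add, order_pow, order_X_pow, order_mul, order_mul,
    order_X_pow, order_zero_of_unit hgu, add_zero, order_pow, ← coe_toNat_order hB', ← coe_toNat_order hA'] at hord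
  set kB := (PowerSeries.map (Int.castRingHom ℚ) B).order.toNat
  set kA := (PowerSeries.map (Int.castRingHom ℚ) A).order.toNat
  have hnat : 3 * kB + n₁ = n₂ + 3 * kA := by
    have : ((3 * kB + n₁ : ℕ) : ℕ∞) = ((n₂ + 3 * kA : ℕ) : ℕ∞) := by
      push_cast
      simpa [smul_eq_mul] using hord
    exact_mod_cast this
  omega

/-- **R1 (PROVED): N1 `CubeRepFirstDescent` ⟸ M1 ∧ M2.** -/
theorem cubeRepFirstDescent_of (hM1 : EtaQuotientMemFunctionField) (hM2 : MonomialNotModularFunction) :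
    CubeRepFirstDescent := by
  intro N _ Θ hΘ0 r g A B hrep
  obtain ⟨hNew, hEta, hB, -, n₁, n₂, hG, hEq⟩ := hrep
  have h1 := sub_eq_sum_div_of_rep hM1 hM2 hNew hEta (n₁ := n₁) (n₂ := n₂) hG
  have h2 := three_dvd_sub_of_rep hΘ0 hEta.1 hB hEq
  have h24 := hNew.sum_mul_dvd
  omega

/-! ### The cube of the descended `η`-quotient -/

/-- `ℤ`-bookkeeping: `(t/3).toNat * 3 = t.toNat` when `3 ∣ t`. [folklore] -/
theorem toNat_mul_three_of_dvd {t : ℤ} (h : (3 : ℤ) ∣ t) : (t / 3).toNat * 3 = t.toNat := by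
  obtain ⟨k, rfl⟩ := h; omega

/-- `ℤ`-bookkeeping: `(-(t/3)).toNat * 3 = (-t).toNat` when `3 ∣ t`. [folklore] -/
theorem toNat_neg_mul_three_of_dvd {t : ℤ} (h : (3 : ℤ) ∣ t) : (-(t / 3)).toNat * 3 = (-t).toNat := by
  obtain ⟨k, rfl⟩ := h; omega

/-- `etaPos` of the descended exponent vector `r/3` at level `3N`, cubed, is `etaPos` of `r`. [folklore] -/
theorem etaPos_descentExp_pow {N : ℕ} (hN : N ≠ 0) {r : ℕ → ℤ} (h3 : ∀ δ ∈ N.divisors, (3 : ℤ) ∣ r δ) :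
    etaPos (3 * N) (descentExp N r) ^ 3 = etaPos N r := by
  rw [etaPos, etaPos, ← Finset.prod_subset (divisors_subset_divisors_three_mul hN)
      (fun δ _ hδ => by rw [descentExp_of_not_mem hδ]; simp), ← Finset.prod_pow]
  refine Finset.prod_congr rfl fun δ hδ => ?_
  rw [← pow_mul, descentExp_of_mem hδ, toNat_mul_three_of_dvd (h3 δ hδ)]

/-- `etaNeg` of the descended exponent vector `r/3` at level `3N`, cubed, is `etaNeg` of `r`. [folklore] -/
theorem etaNeg_descentExp_pow {N : ℕ} (hN : N ≠ 0) {r : ℕ → ℤ} (h3 : ∀ δ ∈ N.divisors, (3 : ℤ) ∣ r δ) :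
    etaNeg (3 * N) (descentExp N r) ^ 3 = etaNeg N r := by
  rw [etaNeg, etaNeg, ← Finset.prod_subset (divisors_subset_divisors_three_mul hN)
      (fun δ _ hδ => by rw [descentExp_of_not_mem hδ]; simp), ← Finset.prod_pow]
  refine Finset.prod_congr rfl fun δ hδ => ?_
  rw [← pow_mul, descentExp_of_mem hδ, toNat_neg_mul_three_of_dvd (h3 δ hδ)]

/-- `3 · S₁(r/3 at level 3N) = S₁(r)` for the descended exponent vector. [folklore] -/
theorem three_mul_sum_descentExp {N : ℕ} (hN : N ≠ 0) {r : ℕ → ℤ} (h3 : ∀ δ ∈ N.divisors, (3 : ℤ) ∣ r δ) :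
    3 * ∑ δ ∈ (3 * N).divisors, (δ : ℤ) * descentExp N r δ = ∑ δ ∈ N.divisors, (δ : ℤ) * r δ := by
  rw [sum_divisors_three_mul_descentExp hN r (fun δ x => (δ : ℤ) * x) (fun _ => mul_zero _), Finset.mul_sum]
  refine Finset.sum_congr rfl fun δ hδ => ?_
  rw [mul_left_comm, Int.mul_ediv_cancel' (h3 δ hδ)]

/-- `η_{r/3}³ = q^{S₁(r)/24}·g` in `ℂ((q))`. -/
theorem etaLaurent_descentExp_pow {N : ℕ} (hN : N ≠ 0) {r : ℕ → ℤ} {g : ℤ⟦X⟧}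
    (hEta : IsEtaUnitSeries N.divisors r g) (h3 : ∀ δ ∈ N.divisors, (3 : ℤ) ∣ r δ)
    (hs : NewmanCond (3 * N) (descentExp N r) 0) :
    etaLaurent (3 * N) (descentExp N r) ^ 3 =
      HahnSeries.single ((∑ δ ∈ N.divisors, (δ : ℤ) * r δ) / 24) (1 : ℂ) * toLaurent g := by
  have h24 := hs.sum_mul_dvd
  have h3S := three_mul_sum_descentExp hN h3
  set S' := ∑ δ ∈ (3 * N).divisors, (δ : ℤ) * descentExp N r δ
  have hexp : (3 : ℤ) * (S' / 24) = (∑ δ ∈ N.divisors, (δ : ℤ) * r δ) / 24 := by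
    rw [← h3S]; omega
  rw [etaLaurent, mul_pow, single_pow', div_pow, ← toLaurent_pow, ← toLaurent_pow, etaPos_descentExp_pow hN h3,
    etaNeg_descentExp_pow hN h3, ← toLaurent_eq_div_of_isEtaUnitSeries hEta, Nat.cast_ofNat, hexp]

/-- **R2 (PROVED): N2 `NoNewmanCubeRootRepAtThreeN` ⟸ M0 ∧ M1 ∧ M2 ∧ P79.** -/
theorem noNewmanCubeRootRepAtThreeN_of (hM0 : ModularFunctionFieldMono) (hM1 : EtaQuotientMemFunctionField)
    (hM2 : MonomialNotModularFunction) (hP : KummerCubeSeriesNotCubeAtThreeN) : NoNewmanCubeRootRepAtThreeN := by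
  intro W _ _ N _ D a ha h9 hL X₀ Y₀ hT z hz r g A B h3 hs hrep
  obtain ⟨hNew, hEta, hB, hh, n₁, n₂, hG, hEq⟩ := hrep
  have hN : N ≠ 0 := NeZero.ne N
  have he := sub_eq_sum_div_of_rep hM1 hM2 hNew hEta (n₁ := n₁) (n₂ := n₂) hG
  have hΘ := laurent_eq_of_rep hB hEq
  set u : LaurentSeries ℂ := etaLaurent (3 * N) (descentExp N r) * (toLaurent A / toLaurent B) with hu
  have hu_mem : u ∈ modularFunctionField (3 * N) :=
    mul_mem (hM1 (3 * N) (descentExp N r) hs) (hM0 N (3 * N) (Dvd.intro_left 3 rfl) hh)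
  have hcube : HahnSeries.ofPowerSeries ℤ ℂ ((kummerCubeSeries W D.c X₀ Y₀ z).map (algebraMap ℚ ℂ)) = u ^ 3 := by
    rw [hΘ, hu, mul_pow, etaLaurent_descentExp_pow hN hEta h3 hs, ← he]
  exact hP W D a ha h9 hL X₀ Y₀ hT z hz u hu_mem hcube

/-- **LAW₃ from the four leaves (PROVED): M0 ∧ M1 ∧ M2 ∧ P79 ⟹ `CuspidalKummerCubeExponentLaw`.** -/
theorem cuspidalKummerCubeExponentLaw_of_functionField (hM0 : ModularFunctionFieldMono)
    (hM1 : EtaQuotientMemFunctionField) (hM2 : MonomialNotModularFunction) (hP : KummerCubeSeriesNotCubeAtThreeN) :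
    CuspidalKummerCubeExponentLaw :=
  cuspidalKummerCubeExponentLaw_of_descent (cubeRepFirstDescent_of hM1 hM2)
    (noNewmanCubeRootRepAtThreeN_of hM0 hM1 hM2 hP)

/-- LAW₃♮ (C3 v18 stub 3) from the four leaves, BY NAME. -/
theorem cuspidalKummerCubeExponentLawNonBlind_of_functionField (hM0 : ModularFunctionFieldMono)
    (hM1 : EtaQuotientMemFunctionField) (hM2 : MonomialNotModularFunction) (hP : KummerCubeSeriesNotCubeAtThreeN) :
    CuspidalKummerCubeExponentLawNonBlind :=
  cuspidalKummerCubeExponentLawNonBlind_of_law (cuspidalKummerCubeExponentLaw_of_functionField hM0 hM1 hM2 hP)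

/-- **NB₃ `NoBlindThreeTorsionOptimal` (C3 v18 derived stub) from the four leaves AND K_geo₃ (E-an-57)**, through
the tree edge `noBlind_of_cuspidalKummerCubeExponentLaw_of_representative`. -/
theorem noBlindThreeTorsionOptimal_of_functionField (hM0 : ModularFunctionFieldMono)
    (hM1 : EtaQuotientMemFunctionField) (hM2 : MonomialNotModularFunction) (hP : KummerCubeSeriesNotCubeAtThreeN)
    (h57 : CuspidalKummerCubeRepresentativeAtNine) : NoBlindThreeTorsionOptimal :=
  noBlind_of_cuspidalKummerCubeExponentLaw_of_representative
    (cuspidalKummerCubeExponentLaw_of_functionField hM0 hM1 hM2 hP) h57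

end Summit.BirchSwinnertonDyer.BirchSwinnertonDyer.Theorems.ManinLocalTwoThree.CubeRootDescent
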